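import Summits.BirchSwinnertonDyer.BirchSwinnertonDyer.Theorems.SylvesterTwoHeegnerIndexThmCOfCMPointLaws
import HarnessLib

/-!
# Route `SylvesterTwoHeegnerIndex` (rung K7t): THEOREM C (item 19802) from the CM-point laws in
# TRACE FORM — Hu–Shu–Yin Cor 2.5 for the FULL trace `R` verbatim, `R = 2R′`, and `E₁(L)[2] = 0`

HONEST FRAMING (cell b2b-bsdres, seat x1b GEN 51 = O12 class lead; file `--supports
stmt-BirchSwinnertonDyer-19802 --as helper`; THEOREM C stays OPEN). Sequel of
`…ThmCOfCMPointLaws.lean`: there the law on the HALF-trace point `R′` («`σR′ = [ω]R′ + t′`,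
`t′ ∈ E₁[√−3]`») is the memo's adaptation of [HuShuYin2019] Cor 2.5 (MEMO-bsd-cm-two §15.5 (C-d): «As in
[HSY Cor 2.5] … each of the `(p−1)/6` conjugates contributes `φ` of the cusp»). Here the hypothesis is put
in PRINT-VERBATIM form: Cor 2.5 itself, for the FULL trace `R = Tr_{H_{3p}/L_{(p)}} φ(P₀) ∈ E₁(L_{(p)})`,
`p ≡ 7 (mod 9)`: **`R^{σ_{ω₃}} = [ω]R + (0, −12√−3)`** (p. 7), together with the cell's `R = 2R′`
(σ_{−1} fixes `P₀`, memo (C-b)+(C-c)+(C-d)₁) and the field fact `E₁(L)[2] = 0` (`∛2 ∉ L = K(∛p)`), from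
which the half-trace law follows by pure algebra:

* §1 `map_eq_rootMul_add_neg_of_two_nsmul` — additive `s, θ` on an abelian group without `2`-torsion:
  `s(2R′) = θ(2R′) + t`, `3t = 0` ⟹ `sR′ = θR′ + (−t)` (since `2(sR′ − θR′ + t) = 3t = 0`);
* §2 `neg_some_zero` — on a Mordell equation `−(0, y) = (0, −y)`, so `−t ∈ E₁[√−3]` when `t` is;
* §3 `exists_eq_two_smul_add_torsion_of_cmPointLaws_trace` (one `p`, model level) and
  **`hsyPointTwoDivisibleSevenModNine_of_cmPointLaws_trace`**: display fact + (TRACE-LAWS_p for every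
  `p ≡ 7 (9)`) ⟹ the ROUTE DECL `Theses.SylvesterTwoHeegnerIndex.HSYPointTwoDivisibleSevenModNine`, where
  TRACE-LAWS_p = the data of (LAWS_p) with the `R′`-law replaced by **Cor 2.5 for `R = 2•R′`**
  (`σ(2R′) = [ω](2R′) + t`, `t ∈ {𝒪, (0, ±12√−3)}`) **+ `E₁(L)` has no `2`-torsion**.

NO definition, NO named fact, NO sorry; axioms standard; closes no item; nothing booked; no label moves.
References: [HuShuYin2019] p. 7 (Cor 2.5, `(∛p)^{σ_{ω₃}−1} = ω` for `p ≡ 7 (9)`), p. 8; MEMO-bsd-cm-two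
v2.8 §15.5 (C-d), §40.1.
-/

set_option autoImplicit false
-- the Summit-side namespace `Summit.BirchSwinnertonDyer.BirchSwinnertonDyer.…` (summit = problem) is mandated by D-0017
set_option linter.dupNamespace false

noncomputable section

open scoped Classical

open WeierstrassCurve WeierstrassCurve.Affine WeierstrassCurve.Affine.Point

namespace Summit.BirchSwinnertonDyer.BirchSwinnertonDyer.Theorems.SylvesterTwoThmCTwist

open SylvesterTwoCMNormForm SylvesterTwoThmCTorsion
open Literature.NumberTheory.EllipticCurves Literature.NumberTheory.EllipticCurves.HuShuYin2019

/-! ## §1 From the full-trace law to the half-trace law (no `2`-torsion) -/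

/-- **Half-trace law from the trace law.** In an abelian group without `2`-torsion, for additive `s, θ`:
`s(2•R′) = θ(2•R′) + t` and `3•t = 0` give `s R′ = θ R′ + (−t)` — because
`2•(sR′ − θR′ + t) = (s(2R′) − θ(2R′)) + 2t = 3•t = 0`. (Memo (C-d): Cor 2.5 for `R = 2R′` ⟹ the law for
`R′` with `t′ = −t`.) [cite: HuShuYin2019, p. 7 (Cor. 2.5)] -/
theorem map_eq_rootMul_add_neg_of_two_nsmul {A : Type*} [AddCommGroup A] (s θ : A →+ A) {R' t : A}
    (hR : s ((2 : ℕ) • R') = θ ((2 : ℕ) • R') + t) (ht3 : (3 : ℕ) • t = 0)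
    (h2 : ∀ Q : A, (2 : ℕ) • Q = 0 → Q = 0) : s R' = θ R' + -t := by
  have h : (2 : ℕ) • (s R' - θ R' + t) = 0 := by
    have e : (2 : ℕ) • (s R' - θ R' + t) = (s ((2 : ℕ) • R') - θ ((2 : ℕ) • R')) + (2 : ℕ) • t := by
      rw [map_nsmul, map_nsmul, smul_add, smul_sub]
    rw [e, hR, add_sub_cancel_left, ← succ_nsmul']
    exact ht3
  have h0 := h2 _ h
  rw [← sub_eq_zero]
  rw [← h0]
  abel

/-! ## §2 `−(0, y) = (0, −y)` on a Mordell equation -/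

/-- On a Weierstrass equation with `a₁ = a₃ = 0`, the negative of an affine point `(0, y)` is `(0, −y)`.
[cite: SilvermanAEC2009, III.2.3] -/
theorem neg_some_zero {F : Type*} [Field F] {W : WeierstrassCurve F} (h1 : W.a₁ = 0) (h3 : W.a₃ = 0)
    {y : F} (h : W.toAffine.Nonsingular 0 y) (h' : W.toAffine.Nonsingular 0 (-y)) :
    -(Affine.Point.some (W' := W.toAffine) 0 y h) = .some 0 (-y) h' := by
  rw [Affine.Point.neg_some]
  simp only [Affine.negY, h1, h3, zero_mul, sub_zero]

/-! ## §3 THEOREM C from the CM-point laws in trace form -/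

section Model

variable {K : Type} [Field K] [NumberField K] {ω : K} (hω : ω ^ 2 + ω + 1 = 0)
  {L : Type} [Field L] [CharZero L] [Algebra K L]
  {p : ℕ} {c : L} (hc : c ^ 3 = ((p : ℚ) : L)) (hp0 : (p : ℚ) ≠ 0)

include hω hc hp0 in
/-- **THE (C-d) ASSEMBLY FOR ONE PRIME, TRACE FORM.** As `exists_eq_two_smul_add_torsion_of_cmPointLaws`,
but with Hu–Shu–Yin's Cor 2.5 for the FULL trace point `R = 2•R′` — `σ(2•R′) = [ω](2•R′) + t`,
`t ∈ {𝒪, (0, ±12√−3)}` — and the hypothesis that `E₁(L)` has no `2`-torsion (`∛2 ∉ L`); `σ`, `[ω]`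
additive. THEN `Y = 2•Y′ + T″` in `B(K)` with `T″` torsion. [cite: HuShuYin2019, p. 7 (Cor. 2.5), p. 8] -/
theorem exists_eq_two_smul_add_torsion_of_cmPointLaws_trace [IsGalois K L]
    (B : WeierstrassCurve ℚ) [B.IsElliptic] (C : VariableChange ℚ)
    (hCK : (C • B).baseChange K = (cubeSumCurve (p : ℚ)).baseChange K)
    (σ : L ≃ₐ[K] L) (hgen : ∀ τ : L ≃ₐ[K] L, τ = 1 ∨ τ = σ ∨ τ = σ * σ)
    (hσc : σ c = algebraMap K L ω * c)
    {θ : ((cubeSumCurve 1).baseChange L).toAffine.Point → ((cubeSumCurve 1).baseChange L).toAffine.Point}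
    (hθ0 : θ 0 = 0)
    (hθ : ∀ (x y : L) (h : ((cubeSumCurve 1).baseChange L).toAffine.Nonsingular x y),
      θ (.some x y h) = .some (algebraMap K L ω * x) y
        (nonsingular_rootMul (cubeSumCurve_baseChange_a₁ 1) (cubeSumCurve_baseChange_a₂ 1)
          (cubeSumCurve_baseChange_a₃ 1) (cubeSumCurve_baseChange_a₄ 1)
          (omega_pow_three (omega_algebraMap (L := L) hω)) h))
    (hθadd : ∀ P Q, θ (P + Q) = θ P + θ Q)
    {φ : ((cubeSumCurve 1).baseChange L).toAffine.Point → ((cubeSumCurve (p : ℚ)).baseChange L).toAffine.Point}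
    (hφ0 : φ 0 = 0)
    (hφ : ∀ (x y : L) (h : ((cubeSumCurve 1).baseChange L).toAffine.Nonsingular x y),
      φ (.some x y h) = .some (c ^ 2 * x) (c ^ 3 * y)
        (nonsingular_twist (cbrt_ne_zero hc hp0) (cubeSumCurve_baseChange_a₁ 1)
          (cubeSumCurve_baseChange_a₂ 1) (cubeSumCurve_baseChange_a₃ 1) (cubeSumCurve_baseChange_a₄ 1)
          (cubeSumCurve_baseChange_a₁ p) (cubeSumCurve_baseChange_a₂ p) (cubeSumCurve_baseChange_a₃ p)
          (cubeSumCurve_baseChange_a₄ p) (cubeSumCurve_baseChange_a₆_twist hc) h))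
    (hφadd : ∀ P Q, φ (P + Q) = φ P + φ Q)
    (h2 : ∀ Q : ((cubeSumCurve 1).baseChange L).toAffine.Point, (2 : ℕ) • Q = 0 → Q = 0)
    {R' t T : ((cubeSumCurve 1).baseChange L).toAffine.Point}
    (hR : Affine.Point.map (σ : L →ₐ[K] L) ((2 : ℕ) • R') = θ ((2 : ℕ) • R') + t)
    (ht : t = 0 ∨
      (∃ h, t = .some 0 (12 * (2 * algebraMap K L ω + 1)) h) ∨
      (∃ h, t = .some 0 (-(12 * (2 * algebraMap K L ω + 1))) h))
    (hT : (3 : ℕ) • T = 0)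
    (Y : (B.baseChange K).toAffine.Point)
    (hY : Affine.Point.map (algebraMap K L).toRatAlgHom
        (Affine.Point.congrEquiv hCK (VariableChange.pointEquivBaseChange B C K Y)) =
      φ ((2 : ℕ) • R' - T)) :
    ∃ Y' T'' : (B.baseChange K).toAffine.Point, IsOfFinAddOrder T'' ∧ Y = (2 : ℤ) • Y' + T'' := by
  have hωL := omega_algebraMap (L := L) hω
  have h2L : (2 : L) ≠ 0 := by norm_num
  have h3L : (3 : L) ≠ 0 := by norm_num
  have ha1 := cubeSumCurve_baseChange_a₁ (L := L) 1
  have ha2 := cubeSumCurve_baseChange_a₂ (L := L) 1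
  have ha3 := cubeSumCurve_baseChange_a₃ (L := L) 1
  have ha4 := cubeSumCurve_baseChange_a₄ (L := L) 1
  have ha6 := cubeSumCurve_one_baseChange_a₆ (L := L)
  -- `3•t = 0`: `t ∈ E₁[√−3] ⊂ E₁[3]`
  have ht3 : (3 : ℕ) • t = 0 := by
    rcases ht with rfl | ⟨h, rfl⟩ | ⟨h, rfl⟩
    · exact smul_zero _
    · exact three_nsmul_eq_zero_of_X_eq_zero ha1 ha2 ha3 ha4 h
    · exact three_nsmul_eq_zero_of_X_eq_zero ha1 ha2 ha3 ha4 h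
  -- the half-trace law with `t′ = −t`
  have hR' : Affine.Point.map (σ : L →ₐ[K] L) R' = θ R' + -t := by
    have e := map_eq_rootMul_add_neg_of_two_nsmul (Affine.Point.map (σ : L →ₐ[K] L))
      (AddMonoidHom.mk' θ hθadd) (R' := R') (t := t)
      (by simpa only [AddMonoidHom.mk'_apply] using hR) ht3 h2
    simpa only [AddMonoidHom.mk'_apply] using e
  -- `−t ∈ E₁[√−3]`
  have ht' : -t = 0 ∨
      (∃ h, -t = .some 0 (12 * (2 * algebraMap K L ω + 1)) h) ∨
      (∃ h, -t = .some 0 (-(12 * (2 * algebraMap K L ω + 1))) h) := by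
    rcases ht with rfl | ⟨h, rfl⟩ | ⟨h, rfl⟩
    · exact Or.inl _root_.neg_zero
    · refine Or.inr (Or.inr ⟨nonsingular_zero_neg_twelveSqrt h2L ha1 ha2 ha3 ha4 ha6 hωL h3L, ?_⟩)
      exact neg_some_zero ha1 ha3 h _
    · refine Or.inr (Or.inl ⟨nonsingular_zero_twelveSqrt h2L ha1 ha2 ha3 ha4 ha6 hωL h3L, ?_⟩)
      rw [neg_some_zero ha1 ha3 h (by rw [neg_neg]; exact nonsingular_zero_twelveSqrt h2L ha1 ha2 ha3 ha4 ha6 hωL h3L)]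
      simp only [neg_neg]
  exact exists_eq_two_smul_add_torsion_of_cmPointLaws hω hc hp0 B C hCK σ hgen hσc hθ0 hθ hθadd hφ0 hφ hφadd
    hR' ht' hT Y hY

end Model

/-- **THEOREM C FROM THE CM-POINT LAWS IN TRACE FORM** (route decl): the printed display (tree fact) +
for every `p ≡ 7 (9)` the data TRACE-LAWS_p — as (LAWS_p) of `…ThmCOfCMPointLaws` but with Hu–Shu–Yin's
Cor 2.5 VERBATIM for the full trace `R = 2•R′` («`R^{σ_{ω₃}} = [ω]R + (0, −12√−3)`», here
`t ∈ {𝒪, (0, ±12√−3)}`), the cell's halving `R = 2•R′` built into the shape of `Y = φ′(2•R′ − T)`, and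
`E₁(L)` without `2`-torsion — ⟹ `HSYPointTwoDivisibleSevenModNine`. The item stays OPEN (the halving =
«`σ_{−1}` fixes `P₀`», Shimura reciprocity; the display for the explicit `Y`; no tree carrier).
[cite: HuShuYin2019, p. 7 (Cor. 2.5), pp. 8, 12] -/
theorem hsyPointTwoDivisibleSevenModNine_of_cmPointLaws_trace
    (hH : shaAnPair_mul_height_eq_two_zpow_mul_height)
    (hLaws : ∀ (p : ℕ), p.Prime → p % 9 = 7 → (¬ ∃ x : ZMod p, x ^ 3 = 3) →
      ∀ (A B : WeierstrassCurve ℚ) [A.IsElliptic] [A.IsGloballyMinimal] [B.IsElliptic] [B.IsGloballyMinimal],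
      (∃ C : VariableChange ℚ, C • B = cubeSumCurve (p : ℚ)) →
      (∃ C : VariableChange ℚ, C • A = cubeSumCurve (3 * (p : ℚ) ^ 2)) →
      ∀ (qB qA : ℚ), shaAn B = (qB : ℂ) → shaAn A = (qA : ℂ) →
      ∃ (K : Type) (_ : Field K) (_ : NumberField K) (ω : K) (_ : ω ^ 2 + ω + 1 = 0)
        (_ : Module.finrank ℚ K = 2) (_ : (B.baseChange K).mordellWeilRank = 2)
        (P₀ : B.toAffine.Point) (_ : ¬ IsOfFinAddOrder (QuadraticDescent.incl K B P₀))
        (_ : ∀ Q : B.toAffine.Point, ∃ m : ℤ,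
          IsOfFinAddOrder (QuadraticDescent.incl K B Q - m • QuadraticDescent.incl K B P₀))
        (C : VariableChange ℚ) (_ : C • B = cubeSumCurve (p : ℚ))
        (hCK : (C • B).baseChange K = (cubeSumCurve (p : ℚ)).baseChange K)
        (L : Type) (_ : Field L) (_ : CharZero L) (_ : Algebra K L) (_ : IsGalois K L)
        (σ : L ≃ₐ[K] L) (_ : ∀ τ : L ≃ₐ[K] L, τ = 1 ∨ τ = σ ∨ τ = σ * σ)
        (c : L) (_ : c ^ 3 = ((p : ℚ) : L)) (_ : σ c = algebraMap K L ω * c)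
        (θ : ((cubeSumCurve 1).baseChange L).toAffine.Point → ((cubeSumCurve 1).baseChange L).toAffine.Point)
        (_ : θ 0 = 0)
        (_ : ∀ (x y : L) (h : ((cubeSumCurve 1).baseChange L).toAffine.Nonsingular x y),
          ∃ h', θ (.some x y h) = .some (algebraMap K L ω * x) y h')
        (_ : ∀ P Q, θ (P + Q) = θ P + θ Q)
        (φ : ((cubeSumCurve 1).baseChange L).toAffine.Point →
          ((cubeSumCurve (p : ℚ)).baseChange L).toAffine.Point)
        (_ : φ 0 = 0)
        (_ : ∀ (x y : L) (h : ((cubeSumCurve 1).baseChange L).toAffine.Nonsingular x y),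
          ∃ h', φ (.some x y h) = .some (c ^ 2 * x) (c ^ 3 * y) h')
        (_ : ∀ P Q, φ (P + Q) = φ P + φ Q)
        (_ : ∀ Q : ((cubeSumCurve 1).baseChange L).toAffine.Point, (2 : ℕ) • Q = 0 → Q = 0)
        (R' t T : ((cubeSumCurve 1).baseChange L).toAffine.Point)
        (_ : Affine.Point.map (σ : L →ₐ[K] L) ((2 : ℕ) • R') = θ ((2 : ℕ) • R') + t)
        (_ : t = 0 ∨ (∃ h, t = .some 0 (12 * (2 * algebraMap K L ω + 1)) h) ∨
          (∃ h, t = .some 0 (-(12 * (2 * algebraMap K L ω + 1))) h))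
        (_ : (3 : ℕ) • T = 0)
        (Y : (B.baseChange K).toAffine.Point)
        (_ : Affine.Point.map (algebraMap K L).toRatAlgHom
            (Affine.Point.congrEquiv hCK (VariableChange.pointEquivBaseChange B C K Y)) =
          φ ((2 : ℕ) • R' - T)),
        ((qB * qA : ℚ) : ℝ) * canonicalHeight (QuadraticDescent.incl K B P₀) =
          (2 : ℝ) ^ (-2 : ℤ) * canonicalHeight Y ∧ qB * qA ≠ 0) :
    Summit.BirchSwinnertonDyer.BirchSwinnertonDyer.Theses.SylvesterTwoHeegnerIndex.HSYPointTwoDivisibleSevenModNine := by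
  refine SylvesterTwoNonneg.hsyPointTwoDivisibleSevenModNine_of_heightDisplay_of_twoIntegral hH ?_
  intro p hp h7 h3 A B _ _ _ _ hB hA qB qA hqB hqA
  obtain ⟨K, _, _, ω, hω, h2K, hrank, P₀, hP, hgen, C, hC, hCK, L, _, _, _, _, σ, hg, c, hc, hσc, θ, hθ0,
    hθ', hθadd, φ, hφ0, hφ', hφadd, h2, R', t, T, hR, ht, hT, Y, hY, hid, hq⟩ :=
    hLaws p hp h7 h3 A B hB hA qB qA hqB hqA
  have hp2 : p ≠ 2 := by rintro rfl; norm_num at h7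
  have hp0 : (p : ℚ) ≠ 0 := by exact_mod_cast hp.ne_zero
  have hθ : ∀ (x y : L) (h : ((cubeSumCurve 1).baseChange L).toAffine.Nonsingular x y),
      θ (.some x y h) = .some (algebraMap K L ω * x) y
        (nonsingular_rootMul (cubeSumCurve_baseChange_a₁ 1) (cubeSumCurve_baseChange_a₂ 1)
          (cubeSumCurve_baseChange_a₃ 1) (cubeSumCurve_baseChange_a₄ 1)
          (omega_pow_three (omega_algebraMap (L := L) hω)) h) := by
    intro x y h; obtain ⟨_, e⟩ := hθ' x y h; exact e
  have hφ : ∀ (x y : L) (h : ((cubeSumCurve 1).baseChange L).toAffine.Nonsingular x y),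
      φ (.some x y h) = .some (c ^ 2 * x) (c ^ 3 * y)
        (nonsingular_twist (cbrt_ne_zero hc hp0) (cubeSumCurve_baseChange_a₁ 1)
          (cubeSumCurve_baseChange_a₂ 1) (cubeSumCurve_baseChange_a₃ 1) (cubeSumCurve_baseChange_a₄ 1)
          (cubeSumCurve_baseChange_a₁ p) (cubeSumCurve_baseChange_a₂ p) (cubeSumCurve_baseChange_a₃ p)
          (cubeSumCurve_baseChange_a₄ p) (cubeSumCurve_baseChange_a₆_twist hc) h) := by
    intro x y h; obtain ⟨_, e⟩ := hφ' x y h; exact e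
  have h2div := exists_eq_two_smul_add_torsion_of_cmPointLaws_trace hω hc hp0 B C hCK σ hg hσc hθ0 hθ
    hθadd hφ0 hφ hφadd h2 hR ht hT Y hY
  have hle := SylvesterTwoNonneg.add_two_le_padicValRat_two_of_model_of_twoDivisible hω h2K hp hp2 B C hC
    hrank P₀ hP hgen Y hq hid h2div
  linarith

/-! ## §4 APPEND ⟦x1b GEN 51⟧ — the `2`-torsion hypothesis from «`∛2 ∉ L`»

The hypothesis `h2 : ∀ Q ∈ E₁(L), 2•Q = 0 → Q = 0` of §3 is a FIELD fact: a `2`-torsion affine point of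
`y² = x³ − 432` is `(x, 0)` with `x³ = 432 = 2·6³`, i.e. `(x/6)³ = 2`. So it holds as soon as `L` contains
no cube root of `2` (for `L = L_{(p)} = ℚ(ω, ∛p)`, `p ≠ 2` prime: Kummer theory — not proved here). -/

/-- **No `2`-torsion on `E₁ : y² = x³ − 432` over a field without a cube root of `2`** (`2, 3 ≠ 0`): a point
`Q` with `2•Q = 0` is `𝒪` — else `Q = (x, 0)` with `x³ = 432 = 2·6³`, `(x/6)³ = 2`. [cite: SilvermanAEC2009, III.2.3] -/
theorem eq_zero_of_two_nsmul_eq_zero_of_forall_pow_three_ne_two {F : Type*} [Field F] {W : WeierstrassCurve F}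
    (h2F : (2 : F) ≠ 0) (h3F : (3 : F) ≠ 0) (h1 : W.a₁ = 0) (h2 : W.a₂ = 0) (h3 : W.a₃ = 0) (h4 : W.a₄ = 0)
    (h6 : W.a₆ = -432) (hcbrt : ∀ z : F, z ^ 3 ≠ 2) (Q : W.toAffine.Point) (hQ : (2 : ℕ) • Q = 0) :
    Q = 0 := by
  rcases Q with _ | ⟨x, y, h⟩
  · rfl
  · exfalso
    rw [two_nsmul, add_eq_zero_iff_eq_neg, Affine.Point.neg_some] at hQ
    simp only [Affine.Point.some.injEq, true_and, Affine.negY, h1, h3, zero_mul, sub_zero] at hQ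
    have hy : y = 0 := by
      have e : (2 : F) * y = 0 := by linear_combination hQ
      rcases mul_eq_zero.mp e with e | e
      · exact absurd e h2F
      · exact e
    have heq := h.left
    rw [Affine.equation_iff] at heq
    simp only [h1, h2, h3, h4, h6, hy, zero_mul, mul_zero, add_zero] at heq
    have h6F : (6 : F) ≠ 0 := by
      have : (6 : F) = 2 * 3 := by norm_num
      rw [this]; exact mul_ne_zero h2F h3F
    apply hcbrt (x / 6)
    field_simp
    linear_combination -heq

/-- **`E₁(L)` has no `2`-torsion when `∛2 ∉ L`** (`L` of characteristic `0`): the hypothesis `h2` of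
`exists_eq_two_smul_add_torsion_of_cmPointLaws_trace` / `hsyPointTwoDivisibleSevenModNine_of_cmPointLaws_trace`
for `E₁ = cubeSumCurve 1`. [cite: HuShuYin2019, p. 8] -/
theorem cubeSumCurve_one_eq_zero_of_two_nsmul_eq_zero {L : Type*} [Field L] [CharZero L]
    (hcbrt : ∀ z : L, z ^ 3 ≠ 2) (Q : ((cubeSumCurve 1).baseChange L).toAffine.Point)
    (hQ : (2 : ℕ) • Q = 0) : Q = 0 :=
  eq_zero_of_two_nsmul_eq_zero_of_forall_pow_three_ne_two (by norm_num) (by norm_num)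
    (cubeSumCurve_baseChange_a₁ 1) (cubeSumCurve_baseChange_a₂ 1) (cubeSumCurve_baseChange_a₃ 1)
    (cubeSumCurve_baseChange_a₄ 1) cubeSumCurve_one_baseChange_a₆ hcbrt Q hQ

end Summit.BirchSwinnertonDyer.BirchSwinnertonDyer.Theorems.SylvesterTwoThmCTwist

end
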